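import Mathlib
import Literature.NumberTheory.LFunctions.VinogradovZetaSumShift
import Summits.ValiantsHypothesis.ValiantsHypothesis.Theorems.LiouvilleSarnakAlignedTypeICharactersMod2nBilinearSieveGrowthFromCharSums
import HarnessLib

/-!
# Route LiouvilleSarnak — support `AlignedTypeI` (stmt-ValiantsHypothesis-21040), line `characters_mod_2n`:
# first bricks for `HS` (short character sums mod `2^j`): Gallagher's averaged shift and the `2`-power Lemma 6.5

After `…BilinearSieveGrowthFromCharSums.lean` the leaf's residual is `HS` (`Σ_{n ≤ N} χ(n) ≪ N e^{−c log³N/log²q}`,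
`χ` primitive mod `q = 2^j`) — the depth-aspect analogue of Ivić's Theorem 6.2, whose `t`-aspect proof the tree holds
(`VinogradovZetaSumEstimate.lean`).  Its first ingredient (of four) is an adapter of a tree lemma, recorded here:

* `norm_sum_Ioc_le_shift_avg` — **the averaged additive shift** (Gallagher 1972; Ivić (6.36) without Taylor error):
  for `|f| ≤ 1`, `‖Σ_{M<n≤M+N} f(n)‖ ≤ a^{-2} Σ_{M<n≤M+N} ‖Σ_{x,y≤a} f(n + Dxy)‖ + 2Da²`
  (from the tree's `VinogradovZetaSum.norm_sum_Ioc_sub_sum_Ioc_shift_le`);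
* `char_shift_odd` / `char_shift_even` — for `χ` mod `2^j` and odd `n`: `χ(n + 2^τxy) = χ(n)·χ(1 + 2^τ n̄ xy)`, and `= 0` for even `n`
  (`τ ≥ 1`), so the inner sums are the Postnikov sums `Σ_{x,y≤a} χ(1 + 2^τ n̄ xy)` (`norm_sum_char_shift_le`);
* (not restated here) Ivić's Lemma 6.5 for a `2`-power rational `α = b/2^e`, `b` odd — the Korobov factor
  `Σ_{|μ| ≤ A−1} min(2A, 1/(2‖αμ‖)) ≤ ((2A−1)/2^e + 2)(4A + 2^e(1 + log 2^e))` — IS the tree's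
  `MoebiusWalsh.sum_Ico_geomBound_mul_div_le` (reindex `μ = n − (A−1)`, `v₂(b) = 0`).

What remains for `HS` (census): Postnikov's formula `χ(1 + 2^τ z) = e(Σ_m α_m z^m)` with `2^{j−mτ+v₂(m)}α_m` odd
(truncated `2`-adic logarithm; Mathlib's `PowerSeries.log`), and the parameter choice / exponent bookkeeping on the
tree's `VKZeta.norm_Usum_pow_le` + `J_le_four`.

HONEST FRAMING. Helper lemmas only (unconditional); the leaf `AlignedTypeI` is NOT closed here; nothing bears on
`VP ≠ VNP` (NOT proved).
-/

set_option linter.dupNamespace false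

noncomputable section

namespace Summit.ValiantsHypothesis.ValiantsHypothesis.Theorems.LiouvilleSarnak.AlignedTypeI.CharactersModTwoN

open Finset
open Literature.NumberTheory.LFunctions

/-! ### Gallagher's averaged additive shift -/

/-- **The averaged shift** (Gallagher; Ivić (6.36) with no Taylor step): for `‖f‖ ≤ 1`, `a ≥ 1` and any step `D`,
`‖Σ_{M<n≤M+N} f(n)‖ ≤ a^{-2} Σ_{M<n≤M+N} ‖Σ_{x=1}^{a} Σ_{y=1}^{a} f(n + Dxy)‖ + 2Da²`. [cite: Ivic1985, Theorem 6.2 (proof, (6.36))] -/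
theorem norm_sum_Ioc_le_shift_avg {f : ℕ → ℂ} (hf : ∀ n, ‖f n‖ ≤ 1) (M N D a : ℕ) (ha : 1 ≤ a) :
    ‖∑ n ∈ Ioc M (M + N), f n‖ ≤
      1 / (a : ℝ) ^ 2 * ∑ n ∈ Ioc M (M + N), ‖∑ x ∈ Icc 1 a, ∑ y ∈ Icc 1 a, f (n + D * x * y)‖ +
        2 * D * (a : ℝ) ^ 2 := by
  set S : ℂ := ∑ n ∈ Ioc M (M + N), f n with hS
  set T : ℕ → ℕ → ℂ := fun x y => ∑ n ∈ Ioc M (M + N), f (n + D * x * y) with hT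
  have ha0 : (0 : ℝ) < a := by exact_mod_cast ha
  have hcard : (Icc 1 a).card = a := by simp
  -- each shifted sum is within `2 D a²` of `S`
  have hclose : ∀ x ∈ Icc 1 a, ∀ y ∈ Icc 1 a, ‖S - T x y‖ ≤ 2 * D * (a : ℝ) ^ 2 := by
    intro x hx y hy
    have h := VinogradovZetaSum.norm_sum_Ioc_sub_sum_Ioc_shift_le hf M (M + N) (D * x * y)
    have hx' := (mem_Icc.1 hx).2
    have hy' := (mem_Icc.1 hy).2
    have hxy : ((D * x * y : ℕ) : ℝ) ≤ D * (a : ℝ) ^ 2 := by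
      have : D * x * y ≤ D * a * a := Nat.mul_le_mul (Nat.mul_le_mul_left _ hx') hy'
      calc ((D * x * y : ℕ) : ℝ) ≤ ((D * a * a : ℕ) : ℝ) := by exact_mod_cast this
        _ = D * (a : ℝ) ^ 2 := by push_cast; ring
    calc ‖S - T x y‖ ≤ 2 * ((D * x * y : ℕ) : ℝ) := h
      _ ≤ 2 * D * (a : ℝ) ^ 2 := by linarith
  -- sum over the `a²` pairs
  have hsum : ‖(a : ℂ) ^ 2 * S - ∑ x ∈ Icc 1 a, ∑ y ∈ Icc 1 a, T x y‖ ≤ (a : ℝ) ^ 2 * (2 * D * (a : ℝ) ^ 2) := by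
    have e1 : (a : ℂ) ^ 2 * S - ∑ x ∈ Icc 1 a, ∑ y ∈ Icc 1 a, T x y =
        ∑ x ∈ Icc 1 a, ∑ y ∈ Icc 1 a, (S - T x y) := by
      rw [sum_congr rfl fun x _ => sum_sub_distrib (s := Icc 1 a) (f := fun _ => S) (g := fun y => T x y),
        sum_sub_distrib]
      simp [sum_const, hcard]
      ring
    rw [e1]
    calc ‖∑ x ∈ Icc 1 a, ∑ y ∈ Icc 1 a, (S - T x y)‖ ≤ ∑ x ∈ Icc 1 a, ‖∑ y ∈ Icc 1 a, (S - T x y)‖ :=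
          norm_sum_le _ _
      _ ≤ ∑ x ∈ Icc 1 a, ∑ y ∈ Icc 1 a, ‖S - T x y‖ := sum_le_sum fun x _ => norm_sum_le _ _
      _ ≤ ∑ x ∈ Icc 1 a, ∑ y ∈ Icc 1 a, 2 * D * (a : ℝ) ^ 2 :=
          sum_le_sum fun x hx => sum_le_sum fun y hy => hclose x hx y hy
      _ = (a : ℝ) ^ 2 * (2 * D * (a : ℝ) ^ 2) := by simp [sum_const, hcard]; ring
  -- exchange the order of summation in the double shifted sum
  have hswap : ∑ x ∈ Icc 1 a, ∑ y ∈ Icc 1 a, T x y =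
      ∑ n ∈ Ioc M (M + N), ∑ x ∈ Icc 1 a, ∑ y ∈ Icc 1 a, f (n + D * x * y) := by
    simp only [hT]
    calc ∑ x ∈ Icc 1 a, ∑ y ∈ Icc 1 a, ∑ n ∈ Ioc M (M + N), f (n + D * x * y)
        = ∑ x ∈ Icc 1 a, ∑ n ∈ Ioc M (M + N), ∑ y ∈ Icc 1 a, f (n + D * x * y) :=
          sum_congr rfl fun x _ => sum_comm
      _ = ∑ n ∈ Ioc M (M + N), ∑ x ∈ Icc 1 a, ∑ y ∈ Icc 1 a, f (n + D * x * y) := sum_comm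
  have hinner : ‖∑ x ∈ Icc 1 a, ∑ y ∈ Icc 1 a, T x y‖ ≤
      ∑ n ∈ Ioc M (M + N), ‖∑ x ∈ Icc 1 a, ∑ y ∈ Icc 1 a, f (n + D * x * y)‖ := by
    rw [hswap]; exact norm_sum_le _ _
  -- divide by `a²`
  have ha2 : (0 : ℝ) < (a : ℝ) ^ 2 := by positivity
  have hnorm_a : ‖(a : ℂ) ^ 2 * S‖ = (a : ℝ) ^ 2 * ‖S‖ := by
    rw [norm_mul, norm_pow, Complex.norm_natCast]
  have h1 : (a : ℝ) ^ 2 * ‖S‖ ≤ ∑ n ∈ Ioc M (M + N), ‖∑ x ∈ Icc 1 a, ∑ y ∈ Icc 1 a, f (n + D * x * y)‖ +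
      (a : ℝ) ^ 2 * (2 * D * (a : ℝ) ^ 2) := by
    have := norm_le_norm_add_norm_sub' ((a : ℂ) ^ 2 * S) (∑ x ∈ Icc 1 a, ∑ y ∈ Icc 1 a, T x y)
    rw [hnorm_a] at this
    linarith
  rw [show ‖S‖ = 1 / (a : ℝ) ^ 2 * ((a : ℝ) ^ 2 * ‖S‖) by rw [one_div, inv_mul_cancel_left₀ ha2.ne']]
  calc 1 / (a : ℝ) ^ 2 * ((a : ℝ) ^ 2 * ‖S‖)
      ≤ 1 / (a : ℝ) ^ 2 * (∑ n ∈ Ioc M (M + N), ‖∑ x ∈ Icc 1 a, ∑ y ∈ Icc 1 a, f (n + D * x * y)‖ +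
          (a : ℝ) ^ 2 * (2 * D * (a : ℝ) ^ 2)) := by gcongr
    _ = 1 / (a : ℝ) ^ 2 * ∑ n ∈ Ioc M (M + N), ‖∑ x ∈ Icc 1 a, ∑ y ∈ Icc 1 a, f (n + D * x * y)‖ +
          2 * D * (a : ℝ) ^ 2 := by rw [mul_add, one_div, inv_mul_cancel_left₀ ha2.ne']

/-! ### The character factorisation behind Postnikov's sums -/

/-- For a character mod `2^j` (`j ≥ 1`), `τ ≥ 1` and EVEN `n`: `χ(n + 2^τ m) = 0`. [folklore] -/
theorem char_shift_even {j τ : ℕ} (hj : 1 ≤ j) (hτ : 1 ≤ τ) (χ : DirichletCharacter ℂ (2 ^ j)) {n : ℕ}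
    (hn : Even n) (m : ℕ) : χ ((n + 2 ^ τ * m : ℕ) : ZMod (2 ^ j)) = 0 := by
  refine χ.map_nonunit ?_
  rw [ZMod.isUnit_iff_coprime]
  intro hcop
  have h2n : 2 ∣ n := even_iff_two_dvd.1 hn
  have h2N : 2 ∣ n + 2 ^ τ * m :=
    (Nat.dvd_add_right h2n).2 (dvd_mul_of_dvd_left (dvd_pow_self 2 (by omega)) m)
  have h2q : 2 ∣ 2 ^ j := dvd_pow_self 2 (by omega)
  have h := Nat.dvd_gcd h2N h2q
  rw [hcop.gcd_eq_one] at h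
  omega

/-- For a character mod `2^j` and ODD `n` (a unit): `χ(n + 2^τ m) = χ(n) · χ(1 + 2^τ n̄ m)`, `n̄ = n⁻¹ (mod 2^j)`. [folklore] -/
theorem char_shift_odd {j : ℕ} (τ : ℕ) (χ : DirichletCharacter ℂ (2 ^ j)) {n : ℕ} (hn : Odd n) (m : ℕ) :
    χ ((n + 2 ^ τ * m : ℕ) : ZMod (2 ^ j)) =
      χ (n : ZMod (2 ^ j)) * χ (1 + (2 : ZMod (2 ^ j)) ^ τ * ((n : ZMod (2 ^ j))⁻¹ * m)) := by
  have hu : IsUnit ((n : ℕ) : ZMod (2 ^ j)) := by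
    rw [ZMod.isUnit_iff_coprime]
    exact Nat.Coprime.pow_right _ hn.coprime_two_right
  rw [← map_mul]
  congr 1
  have hinv : (n : ZMod (2 ^ j)) * (n : ZMod (2 ^ j))⁻¹ = 1 := ZMod.mul_inv_of_unit _ hu
  push_cast
  linear_combination (-((2 : ZMod (2 ^ j)) ^ τ * (m : ZMod (2 ^ j)))) * hinv

/-- **The inner sums are Postnikov sums**: for every `n`,
`‖Σ_{x,y≤a} χ(n + 2^τxy)‖ ≤ ‖Σ_{x,y≤a} χ(1 + 2^τ n̄ xy)‖` (`=` for odd `n`, `0` for even `n`; `j, τ ≥ 1`). [folklore] -/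
theorem norm_sum_char_shift_le {j τ : ℕ} (hj : 1 ≤ j) (hτ : 1 ≤ τ) (χ : DirichletCharacter ℂ (2 ^ j))
    (n a : ℕ) :
    ‖∑ x ∈ Icc 1 a, ∑ y ∈ Icc 1 a, χ ((n + 2 ^ τ * x * y : ℕ) : ZMod (2 ^ j))‖ ≤
      ‖∑ x ∈ Icc 1 a, ∑ y ∈ Icc 1 a,
        χ (1 + (2 : ZMod (2 ^ j)) ^ τ * ((n : ZMod (2 ^ j))⁻¹ * ((x * y : ℕ) : ZMod (2 ^ j))))‖ := by
  rcases Nat.even_or_odd n with hn | hn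
  · have h0 : ∑ x ∈ Icc 1 a, ∑ y ∈ Icc 1 a, χ ((n + 2 ^ τ * x * y : ℕ) : ZMod (2 ^ j)) = 0 := by
      refine sum_eq_zero fun x _ => sum_eq_zero fun y _ => ?_
      rw [mul_assoc]
      exact char_shift_even hj hτ χ hn (x * y)
    rw [h0, norm_zero]
    exact norm_nonneg _
  · have h1 : ∑ x ∈ Icc 1 a, ∑ y ∈ Icc 1 a, χ ((n + 2 ^ τ * x * y : ℕ) : ZMod (2 ^ j)) =
        χ (n : ZMod (2 ^ j)) * ∑ x ∈ Icc 1 a, ∑ y ∈ Icc 1 a,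
          χ (1 + (2 : ZMod (2 ^ j)) ^ τ * ((n : ZMod (2 ^ j))⁻¹ * ((x * y : ℕ) : ZMod (2 ^ j)))) := by
      rw [mul_sum]
      refine sum_congr rfl fun x _ => ?_
      rw [mul_sum]
      refine sum_congr rfl fun y _ => ?_
      rw [mul_assoc]
      exact char_shift_odd τ χ hn (x * y)
    rw [h1, norm_mul]
    have hle : ‖χ (n : ZMod (2 ^ j))‖ ≤ 1 := χ.norm_le_one _
    have h0 : 0 ≤ ‖∑ x ∈ Icc 1 a, ∑ y ∈ Icc 1 a,
        χ (1 + (2 : ZMod (2 ^ j)) ^ τ * ((n : ZMod (2 ^ j))⁻¹ * ((x * y : ℕ) : ZMod (2 ^ j))))‖ := norm_nonneg _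
    nlinarith

/-- ★ **Gallagher's reduction to Postnikov sums** (mod `2^j`, `j ≥ 1`, `τ ≥ 1`, `a ≥ 1`):
`‖Σ_{M<n≤M+N} χ(n)‖ ≤ a^{-2} Σ_{M<n≤M+N} ‖Σ_{x,y≤a} χ(1 + 2^τ n̄ xy)‖ + 2·2^τ a²`.
With Postnikov's formula the inner sums become the bilinear Weyl sums `VKZeta.Usum`. [cite: Ivic1985, Theorem 6.2 (proof, (6.36))] -/
theorem norm_charSum_le_postnikovSums {j τ : ℕ} (hj : 1 ≤ j) (hτ : 1 ≤ τ) (χ : DirichletCharacter ℂ (2 ^ j))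
    (M N a : ℕ) (ha : 1 ≤ a) :
    ‖∑ n ∈ Ioc M (M + N), χ (n : ZMod (2 ^ j))‖ ≤
      1 / (a : ℝ) ^ 2 * ∑ n ∈ Ioc M (M + N), ‖∑ x ∈ Icc 1 a, ∑ y ∈ Icc 1 a,
          χ (1 + (2 : ZMod (2 ^ j)) ^ τ * ((n : ZMod (2 ^ j))⁻¹ * ((x * y : ℕ) : ZMod (2 ^ j))))‖ +
        2 * ((2 ^ τ : ℕ) : ℝ) * (a : ℝ) ^ 2 := by
  have h := norm_sum_Ioc_le_shift_avg (f := fun n : ℕ => χ (n : ZMod (2 ^ j))) (fun n => χ.norm_le_one _)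
    M N (2 ^ τ) a ha
  have hmono : ∑ n ∈ Ioc M (M + N), ‖∑ x ∈ Icc 1 a, ∑ y ∈ Icc 1 a, χ ((n + 2 ^ τ * x * y : ℕ) : ZMod (2 ^ j))‖ ≤
      ∑ n ∈ Ioc M (M + N), ‖∑ x ∈ Icc 1 a, ∑ y ∈ Icc 1 a,
          χ (1 + (2 : ZMod (2 ^ j)) ^ τ * ((n : ZMod (2 ^ j))⁻¹ * ((x * y : ℕ) : ZMod (2 ^ j))))‖ :=
    sum_le_sum fun n _ => norm_sum_char_shift_le hj hτ χ n a
  have ha2 : (0 : ℝ) ≤ 1 / (a : ℝ) ^ 2 := by positivity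
  have h3 := mul_le_mul_of_nonneg_left hmono ha2
  exact h.trans (by linarith [h3])

end Summit.ValiantsHypothesis.ValiantsHypothesis.Theorems.LiouvilleSarnak.AlignedTypeI.CharactersModTwoN
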